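import Mathlib
import Literature.Probability.RandomPlanarGeometry.ConformalRectangle

/-!
# Stub `stub_crossRatioOfAutInvariant` — line `Sketch`, crux `VoronoiHubFromSmirnov` (stmt-CriticalPhenomena-6433)

Card hyperbolic-intensity-exact-ci, symmetry payoff: a functional `G` of four unit-circle points that
is invariant under every disc automorphism `z ↦ e^{iθ}(z - a)/(1 - ā z)` is, on the Cayley images
`(x i - I)/(x i + I)` of strictly increasing real 4-tuples `x`, a function of Cardy's cross-ratio
`Literature.Probability.RandomPlanarGeometry.crossRatio x`.

Proof.  (1) `cr_exists_real_moebius`: two strictly increasing real 4-tuples `x`, `x'` of equal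
cross-ratio are interpolated by a real Möbius map `T = (α t + β)/(γ t + δ)` of POSITIVE determinant,
finite at the four points (explicit matrix `adj(N_{x'}) · N_x`, `N_x : (x₀, x₁, x₂, x₃) ↦ (1, ∞, 0, η)`;
the fourth point is matched exactly because the cross-ratios agree).  (2) `cr_exists_disc_aut`:
conjugating `T` by the Cayley map `C(t) = (t - i)/(t + i)` gives the matrix `[[A, B], [-B̄, -Ā]]`,
`A = (γ-β) + i(α+δ)`, `B = (β+γ) + i(α-δ)`, `|A|² - |B|² = 4 det > 0`, i.e. the disc automorphism with
`a = -B/A`, `e^{iθ} = -A/Ā`, and `e^{iθ}(C t - a)/(1 - ā C t) = C (T t)`.  (3) Hence `G (C ∘ x) =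
G (C ∘ x')` (`cr_G_comp_cayley_eq`), and `F η := G (C ∘ x_η)` for any chosen increasing `x_η` of
cross-ratio `η` works.  All [folklore] (Ahlfors, *Complex Analysis*, Ch. 3 §3).
-/

open Complex

namespace Summit.CriticalPhenomena.CardyFormulaZ2.Cruxes.VoronoiHubFromSmirnov.SketchLine

/-- **Real Möbius interpolation.** Two strictly increasing real 4-tuples with the same Cardy
cross-ratio are related by a real Möbius map `t ↦ (α t + β)/(γ t + δ)` with `αδ - βγ > 0` whose pole
avoids the four points: `α xᵢ + β = x'ᵢ (γ xᵢ + δ)` with `γ xᵢ + δ ≠ 0`. [folklore] -/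
theorem cr_exists_real_moebius (x x' : Fin 4 → ℝ) (hx : StrictMono x) (hx' : StrictMono x')
    (hη : (x 0 - x 1) * (x 2 - x 3) / ((x 0 - x 2) * (x 1 - x 3)) =
      (x' 0 - x' 1) * (x' 2 - x' 3) / ((x' 0 - x' 2) * (x' 1 - x' 3))) :
    ∃ α β γ δ : ℝ, 0 < α * δ - β * γ ∧ ∀ i, γ * x i + δ ≠ 0 ∧
      (α * x i + β) = x' i * (γ * x i + δ) := by
  have h01 : x 0 < x 1 := hx (by decide)
  have h12 : x 1 < x 2 := hx (by decide)
  have h23 : x 2 < x 3 := hx (by decide)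
  have h01' : x' 0 < x' 1 := hx' (by decide)
  have h12' : x' 1 < x' 2 := hx' (by decide)
  have h23' : x' 2 < x' 3 := hx' (by decide)
  have hd1 : (x 0 - x 2) * (x 1 - x 3) ≠ 0 := by
    apply mul_ne_zero <;> linarith
  have hd2 : (x' 0 - x' 2) * (x' 1 - x' 3) ≠ 0 := by
    apply mul_ne_zero <;> linarith
  rw [div_eq_div_iff hd1 hd2] at hη
  refine ⟨-(x' 0 - x' 2) * (x 0 - x 1) * x' 1 + (x' 0 - x' 1) * (x 0 - x 2) * x' 2,
    (x' 0 - x' 2) * (x 0 - x 1) * x' 1 * x 2 - (x' 0 - x' 1) * (x 0 - x 2) * x 1 * x' 2,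
    -(x' 0 - x' 2) * (x 0 - x 1) + (x' 0 - x' 1) * (x 0 - x 2),
    (x' 0 - x' 2) * (x 0 - x 1) * x 2 - (x' 0 - x' 1) * (x 0 - x 2) * x 1, ?_, ?_⟩
  · -- determinant = product of the two positive determinants
    have : (-(x' 0 - x' 2) * (x 0 - x 1) * x' 1 + (x' 0 - x' 1) * (x 0 - x 2) * x' 2) *
        ((x' 0 - x' 2) * (x 0 - x 1) * x 2 - (x' 0 - x' 1) * (x 0 - x 2) * x 1) -
        ((x' 0 - x' 2) * (x 0 - x 1) * x' 1 * x 2 - (x' 0 - x' 1) * (x 0 - x 2) * x 1 * x' 2) *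
        (-(x' 0 - x' 2) * (x 0 - x 1) + (x' 0 - x' 1) * (x 0 - x 2)) =
        ((x 0 - x 1) * (x 0 - x 2) * (x 2 - x 1)) *
        ((x' 0 - x' 1) * (x' 0 - x' 2) * (x' 2 - x' 1)) := by ring
    rw [this]
    apply mul_pos
    · have : 0 < (x 1 - x 0) * (x 2 - x 0) := mul_pos (by linarith) (by linarith)
      nlinarith
    · have : 0 < (x' 1 - x' 0) * (x' 2 - x' 0) := mul_pos (by linarith) (by linarith)
      nlinarith
  · intro i
    fin_cases i
    · refine ⟨?_, by simp; ring⟩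
      have : (-(x' 0 - x' 2) * (x 0 - x 1) + (x' 0 - x' 1) * (x 0 - x 2)) * x 0 +
          ((x' 0 - x' 2) * (x 0 - x 1) * x 2 - (x' 0 - x' 1) * (x 0 - x 2) * x 1) =
          (x 1 - x 0) * (x 2 - x 0) * (x' 2 - x' 1) := by ring
      simp only [Fin.zero_eta, Fin.isValue]
      rw [this]
      exact (mul_pos (mul_pos (sub_pos.2 h01) (sub_pos.2 (h01.trans h12))) (sub_pos.2 h12')).ne' 
    · refine ⟨?_, by simp; ring⟩
      have : (-(x' 0 - x' 2) * (x 0 - x 1) + (x' 0 - x' 1) * (x 0 - x 2)) * x 1 +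
          ((x' 0 - x' 2) * (x 0 - x 1) * x 2 - (x' 0 - x' 1) * (x 0 - x 2) * x 1) =
          (x 1 - x 0) * (x 2 - x 1) * (x' 2 - x' 0) := by ring
      simp only [Fin.mk_one, Fin.isValue]
      rw [this]
      exact (mul_pos (mul_pos (sub_pos.2 h01) (sub_pos.2 h12)) (sub_pos.2 (h01'.trans h12'))).ne' 
    · refine ⟨?_, by simp; ring⟩
      have : (-(x' 0 - x' 2) * (x 0 - x 1) + (x' 0 - x' 1) * (x 0 - x 2)) * x 2 +
          ((x' 0 - x' 2) * (x 0 - x 1) * x 2 - (x' 0 - x' 1) * (x 0 - x 2) * x 1) =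
          (x 2 - x 0) * (x 2 - x 1) * (x' 1 - x' 0) := by ring
      simp only [Fin.reduceFinMk, Fin.isValue]
      rw [this]
      exact (mul_pos (mul_pos (sub_pos.2 (h01.trans h12)) (sub_pos.2 h12)) (sub_pos.2 h01')).ne' 
    · simp only [Fin.reduceFinMk, Fin.isValue]
      constructor
      · -- γ x₃ + δ = (x₃ - x₁)(x₀' - x₂')(k' - η)·… ; show it is nonzero via hη
        intro h0
        have key : ((-(x' 0 - x' 2) * (x 0 - x 1) + (x' 0 - x' 1) * (x 0 - x 2)) * x 3 +
            ((x' 0 - x' 2) * (x 0 - x 1) * x 2 - (x' 0 - x' 1) * (x 0 - x 2) * x 1)) *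
            (x' 3 - x' 1) = (x' 1 - x' 0) * (x 2 - x 0) * (x 3 - x 1) * (x' 2 - x' 1) := by
          linear_combination (-1 : ℝ) * hη
        rw [h0, zero_mul] at key
        have : 0 < (x' 1 - x' 0) * (x 2 - x 0) * (x 3 - x 1) * (x' 2 - x' 1) :=
          mul_pos (mul_pos (mul_pos (sub_pos.2 h01') (sub_pos.2 (h01.trans h12)))
            (sub_pos.2 (h12.trans h23))) (sub_pos.2 h12')
        linarith
      · linear_combination hη

/-- **Cayley conjugation.** A real Möbius map of positive determinant, conjugated by the Cayley map
`C(t) = (t - i)/(t + i)`, is a disc automorphism `z ↦ e^{iθ}(z - a)/(1 - ā z)` with `‖a‖ < 1`: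
explicitly `a = -B/A`, `e^{iθ} = -A/Ā` for `A = (γ-β) + i(α+δ)`, `B = (β+γ) + i(α-δ)`
(`|A|² - |B|² = 4(αδ - βγ)`), and `e^{iθ}(C t - a)/(1 - ā C t) = C t'` whenever
`α t + β = t' (γ t + δ)`, `γ t + δ ≠ 0`. [folklore] -/
theorem cr_exists_disc_aut (α β γ δ : ℝ) (hdet : 0 < α * δ - β * γ) :
    ∃ a : ℂ, ‖a‖ < 1 ∧ ∃ θ : ℝ, ∀ t t' : ℝ, γ * t + δ ≠ 0 → α * t + β = t' * (γ * t + δ) →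
      exp ((θ : ℂ) * I) * (((t : ℂ) - I) / ((t : ℂ) + I) - a) /
        (1 - (starRingEnd ℂ a) * (((t : ℂ) - I) / ((t : ℂ) + I))) =
        ((t' : ℂ) - I) / ((t' : ℂ) + I) := by
  -- the matrix of `C ∘ T ∘ C⁻¹` is `[[A, B], [-B̄, -Ā]]`
  set A : ℂ := ((γ - β : ℝ) : ℂ) + ((α + δ : ℝ) : ℂ) * I with hA
  set B : ℂ := ((β + γ : ℝ) : ℂ) + ((α - δ : ℝ) : ℂ) * I with hB
  have hAc : starRingEnd ℂ A = ((γ : ℂ) - β) - ((α : ℂ) + δ) * I := by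
    apply Complex.ext <;> simp [A]
  have hBc : starRingEnd ℂ B = ((β : ℂ) + γ) - ((α : ℂ) - δ) * I := by
    apply Complex.ext <;> simp [B]
  have hnA : Complex.normSq A = (γ - β) ^ 2 + (α + δ) ^ 2 := by
    rw [hA, Complex.normSq_add_mul_I]
  have hnB : Complex.normSq B = (β + γ) ^ 2 + (α - δ) ^ 2 := by
    rw [hB, Complex.normSq_add_mul_I]
  have hApos : 0 < Complex.normSq A := by rw [hnA]; nlinarith
  have hA0 : A ≠ 0 := by
    intro h; rw [h, map_zero] at hApos; exact lt_irrefl _ hApos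
  have hAc0 : starRingEnd ℂ A ≠ 0 := by
    rwa [Ne, map_eq_zero]
  -- the automorphism data
  refine ⟨-B / A, ?_, ?_⟩
  · rw [norm_div, norm_neg, div_lt_one (norm_pos_iff.2 hA0)]
    have h1 : ‖B‖ ^ 2 < ‖A‖ ^ 2 := by
      rw [Complex.sq_norm, Complex.sq_norm, hnA, hnB]; nlinarith
    exact lt_of_pow_lt_pow_left₀ 2 (norm_nonneg _) h1
  set e : ℂ := -A / starRingEnd ℂ A with he
  have he1 : ‖e‖ = 1 := by
    rw [he, norm_div, norm_neg, Complex.norm_conj, div_self (norm_ne_zero_iff.2 hA0)]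
  refine ⟨Complex.arg e, fun t t' hden hT => ?_⟩
  have hexp : exp ((Complex.arg e : ℂ) * I) = e := by
    have := Complex.norm_mul_exp_arg_mul_I e
    rwa [he1, Complex.ofReal_one, one_mul] at this
  rw [hexp]
  have hconj_a : starRingEnd ℂ (-B / A) = -(starRingEnd ℂ B) / starRingEnd ℂ A := by
    rw [map_div₀, map_neg]
  rw [hAc] at hAc0
  have hA0' : ((γ : ℂ) - β) + ((α : ℂ) + δ) * I ≠ 0 := by
    have : A = ((γ : ℂ) - β) + ((α : ℂ) + δ) * I := by rw [hA]; push_cast; ring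
    rwa [this] at hA0
  rw [hconj_a, he, hAc, hBc, hA, hB]
  push_cast
  have htI : (t : ℂ) + I ≠ 0 := by
    intro h
    have := congrArg Complex.im h
    simp at this
  have ht'I : (t' : ℂ) + I ≠ 0 := by
    intro h
    have := congrArg Complex.im h
    simp at this
  have hkey : (((γ : ℂ) - β) - ((α : ℂ) + δ) * I) * ((t : ℂ) + I) +
      ((t : ℂ) - I) * (((β : ℂ) + γ) - ((α : ℂ) - δ) * I) ≠ 0 := by
    intro h
    have h2 := congrArg Complex.re h
    simp at h2
    apply hden
    linarith
  have hI3 : I ^ 3 = -I := by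
    rw [pow_succ, Complex.I_sq]; ring
  -- abstract the two denominators so that `field_simp` sees the nonvanishing hypotheses
  set D₁ : ℂ := ((γ : ℂ) - β) - ((α : ℂ) + δ) * I with hD₁
  set D₂ : ℂ := ((γ : ℂ) - β) + ((α : ℂ) + δ) * I with hD₂
  have hden2 : (1 : ℂ) - -(((β : ℂ) + γ) - ((α : ℂ) - δ) * I) / D₁ *
      (((t : ℂ) - I) / ((t : ℂ) + I)) ≠ 0 := by
    have hexpr : (1 : ℂ) - -(((β : ℂ) + γ) - ((α : ℂ) - δ) * I) / D₁ *
        (((t : ℂ) - I) / ((t : ℂ) + I)) =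
        (D₁ * ((t : ℂ) + I) + ((t : ℂ) - I) * (((β : ℂ) + γ) - ((α : ℂ) - δ) * I)) /
        (D₁ * ((t : ℂ) + I)) := by
      rw [eq_div_iff (mul_ne_zero hAc0 htI)]
      field_simp
      ring
    rw [hexpr]
    exact div_ne_zero hkey (mul_ne_zero hAc0 htI)
  rw [div_eq_div_iff hden2 ht'I]
  have hβ : (β : ℂ) = t' * (γ * t + δ) - α * t := by
    have : β = t' * (γ * t + δ) - α * t := by linarith
    exact_mod_cast this
  field_simp
  rw [hD₁, hD₂, hβ]
  ring_nf
  simp only [Complex.I_sq, hI3]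
  ring


/-- The Cayley image `(t - i)/(t + i)` of a real number lies on the unit circle. [folklore] -/
theorem cr_norm_cayley (t : ℝ) : ‖((t : ℂ) - I) / ((t : ℂ) + I)‖ = 1 := by
  have htI : (t : ℂ) + I ≠ 0 := by
    intro h
    have := congrArg Complex.im h
    simp at this
  have hconj : starRingEnd ℂ ((t : ℂ) + I) = (t : ℂ) - I := by
    apply Complex.ext <;> simp
  rw [norm_div, ← hconj, Complex.norm_conj, div_self (norm_ne_zero_iff.2 htI)]

/-- **Transitivity step.** An `Aut(𝔻)`-invariant functional takes the same value on the Cayley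
images of two strictly increasing real 4-tuples with equal cross-ratio. [folklore] -/
theorem cr_G_comp_cayley_eq (G : (Fin 4 → ℂ) → ℝ)
    (hG : ∀ (a : ℂ), ‖a‖ < 1 → ∀ (θ : ℝ) (p : Fin 4 → ℂ), (∀ i, ‖p i‖ = 1) →
      G (fun i => exp ((θ : ℂ) * I) * (p i - a) / (1 - (starRingEnd ℂ a) * p i)) = G p)
    (x x' : Fin 4 → ℝ) (hx : StrictMono x) (hx' : StrictMono x')
    (hη : Literature.Probability.RandomPlanarGeometry.crossRatio x =
      Literature.Probability.RandomPlanarGeometry.crossRatio x') :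
    G (fun i => ((x i : ℂ) - I) / ((x i : ℂ) + I)) =
      G (fun i => ((x' i : ℂ) - I) / ((x' i : ℂ) + I)) := by
  obtain ⟨α, β, γ, δ, hdet, hT⟩ := cr_exists_real_moebius x x' hx hx' hη
  obtain ⟨a, ha, θ, hθ⟩ := cr_exists_disc_aut α β γ δ hdet
  have h := hG a ha θ (fun i => ((x i : ℂ) - I) / ((x i : ℂ) + I)) (fun i => cr_norm_cayley (x i))
  have hfun : (fun i => exp ((θ : ℂ) * I) * (((x i : ℂ) - I) / ((x i : ℂ) + I) - a) /
      (1 - (starRingEnd ℂ a) * (((x i : ℂ) - I) / ((x i : ℂ) + I)))) =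
      fun i => ((x' i : ℂ) - I) / ((x' i : ℂ) + I) := by
    funext i
    exact hθ (x i) (x' i) (hT i).1 (hT i).2
  rw [hfun] at h
  exact h.symm

/-- **Stub `stub_crossRatioOfAutInvariant`** (card hyperbolic-intensity-exact-ci of crux
`VoronoiHubFromSmirnov`, line `Sketch`): a functional of four unit-circle points invariant under
all disc automorphisms is, on Cayley images of strictly increasing real 4-tuples, a function of
Cardy's cross-ratio of the tuple. [folklore] -/
theorem stub_crossRatioOfAutInvariant (G : (Fin 4 → ℂ) → ℝ)
    (hG : ∀ (a : ℂ), ‖a‖ < 1 → ∀ (θ : ℝ) (p : Fin 4 → ℂ), (∀ i, ‖p i‖ = 1) →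
      G (fun i => exp ((θ : ℂ) * I) * (p i - a) / (1 - (starRingEnd ℂ a) * p i)) = G p) :
    ∃ F : ℝ → ℝ, ∀ (p : Fin 4 → ℂ) (x : Fin 4 → ℝ), (∀ i, ‖p i‖ = 1) → StrictMono x →
      (∀ i, p i = (x i - I) / (x i + I)) →
      G p = F (Literature.Probability.RandomPlanarGeometry.crossRatio x) := by
  classical
  refine ⟨fun η => if h : ∃ y : Fin 4 → ℝ, StrictMono y ∧
      Literature.Probability.RandomPlanarGeometry.crossRatio y = η then
      G (fun i => ((h.choose i : ℂ) - I) / ((h.choose i : ℂ) + I)) else 0, ?_⟩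
  intro p x _hp hx hpx
  have hex : ∃ y : Fin 4 → ℝ, StrictMono y ∧
      Literature.Probability.RandomPlanarGeometry.crossRatio y =
        Literature.Probability.RandomPlanarGeometry.crossRatio x := ⟨x, hx, rfl⟩
  simp only [dif_pos hex]
  have hp : p = fun i => ((x i : ℂ) - I) / ((x i : ℂ) + I) := funext hpx
  rw [hp]
  exact cr_G_comp_cayley_eq G hG x hex.choose hx hex.choose_spec.1 hex.choose_spec.2.symm

end Summit.CriticalPhenomena.CardyFormulaZ2.Cruxes.VoronoiHubFromSmirnov.SketchLine
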